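import Summits.ABC.ABC.Theses.IsogenyGlueCongruence
import Literature.NumberTheory.EllipticCurves.DegreeConjectureAbcMurtyMinimalModelProofs

/-!
# Height calibration of crux B (`PolyDegreeOfBoundedPrimes`, stmt-ABC-2046, line `Sketch`), II: `P → M`

Sequel to `IsogenyGlueCongruencePolyDegreeOfBoundedPrimesHeightCalibration` (p102896), same notation:
`P` = the consequent of crux B (polynomial modular degree, semistable globally minimal `W/ℚ`, `∃ D` idiom),
`H` = the polynomial height conjecture `max(|Δ_W|, |c₄(W)|³) ≤ C·N^σ` for such `W`,
`M` = some datum of each such `W` has a polynomially bounded Manin constant `|c_D| ≤ M₀·N^a`.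
There `P → H` and `H ∧ M → P` were proved from tree theorems. Here:

* `manin_of_polyDegree` (registered sub-goal of stmt-ABC-2046) — **`P → M` unconditionally**: the datum given
  by `P` itself has `|c| ≤ c² ≤ (C·U/4π²c₂)·N^{κ−1/4}`, by Zagier's identity `4π²c²(f,f) = deg·covol`
  (`zagier_degree_formula_holds`), the Hoffstein–Lockhart lower bound `(f,f) ≥ c₂N^{1/4}`
  (`HoffsteinLockhart1994_peterssonProduct_lower_bound_of_half_lt`, `η = 3/4`) and the ABSOLUTE upper bound
  `covol(Λ_E) ≤ U = max(A₀,1)^{1/7}` for the Néron lattice of a global minimal model, which follows from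
  Silverman's `max(|Δ|,|c₄|³) ≤ A₀·covol^{−7}` (`silverman1986_discriminant_c4_covolume_holds`) and
  `max(|Δ|,|c₄|³) ≥ |Δ_min| ≥ 1` (`WeierstrassCurve.minimalDiscriminantInt_ne_zero`).
* Consequently (with p102896's `polyHeight_of_polyDegree`, `polyDegree_of_polyHeight_of_manin`) the calibration
  is EXACT and hypothesis-free: `P ↔ H ∧ M` and `B ↔ (A → H ∧ M)` — recorded in the sequel file
  `…HeightCalibrationExact.lean` (two-line corollaries). `M` being a theorem in print (Edixhoven 1991;
  Česnavičius 2018 Thm 1.2; Kenku 1982: `|c| ≤ 163` for some datum), crux B is in substance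
  "A ⟹ polynomial Szpiro (height form), semistable case".

No definition, no named fact; statements unfolded. Supports stmt-ABC-2046.
References: Murty 1999 (Thm 1, §2); Frey 1989; Pasten 2024 (§3, Rem. 3.3); Silverman 1986 (Prop. 1.1, Cor. 2.3).
-/

noncomputable section

-- single-conjunct summit ABC: the duplicate ABC.ABC is mandated (CONVENTIONS §2)
set_option linter.dupNamespace false

namespace Summit.ABC.ABC.Theorems

open Literature.NumberTheory.EllipticCurves Literature.NumberTheory.EllipticCurves.ModularForms
open CongruenceSubgroup
open Summit.ABC.ABC.Theses.IsogenyGlueCongruence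

/-! ## `P → M` -/

/-- **`P → M`: a polynomial modular degree bounds the Manin constant of the same datum polynomially.**
From Zagier `4π² c² (f,f) = deg · covol`, `(f,f) ≥ c₂ N^{1/4}` (Hoffstein–Lockhart, `η = 3/4`) and the
absolute upper bound for the covolume of the Néron lattice of a global minimal model (Silverman's inequality
`max(|Δ|,|c₄|³) ≤ A₀ covol^{−7}` with `max(|Δ|,|c₄|³) ≥ |Δ_min| ≥ 1`, `Δ_min ∈ ℤ ∖ {0}`):
`|c| ≤ c² ≤ (C U / 4π²c₂) · N^{κ − 1/4}`, `U = A₀^{1/7}`. So `M` costs nothing beyond `P`. [folklore] -/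
theorem manin_of_polyDegree : (∃ κ C : ℝ, ∀ (W : WeierstrassCurve ℚ) [W.IsElliptic] [W.IsGloballyMinimal] [NeZero (W.conductorNorm ℤ)], W.IsSemistable ℤ → ∃ D : Literature.NumberTheory.EllipticCurves.ModularForms.ModularParametrizationData W (W.conductorNorm ℤ), (D.modularDegree : ℝ) ≤ C * (W.conductorNorm ℤ : ℝ) ^ κ) → ∃ a M₀ : ℝ, ∀ (W : WeierstrassCurve ℚ) [W.IsElliptic] [W.IsGloballyMinimal] [NeZero (W.conductorNorm ℤ)], W.IsSemistable ℤ → ∃ D : Literature.NumberTheory.EllipticCurves.ModularForms.ModularParametrizationData W (W.conductorNorm ℤ), |(D.maninConstant : ℝ)| ≤ M₀ * (W.conductorNorm ℤ : ℝ) ^ a := by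
  intro hP
  obtain ⟨κ, C, hP⟩ := hP
  obtain ⟨c₂, hc₂, hPet⟩ := HoffsteinLockhart1994_peterssonProduct_lower_bound_of_half_lt
    (show (1 : ℝ) / 2 < 3 / 4 by norm_num)
  obtain ⟨A₀, hA₀⟩ := silverman1986_discriminant_c4_covolume_holds 1 one_pos
  -- the absolute covolume bound `U`
  set U : ℝ := (max A₀ 1) ^ (1 / (6 + 1) : ℝ) with hUdef
  have hU : 0 < U := Real.rpow_pos_of_pos (lt_of_lt_of_le one_pos (le_max_right _ _)) _
  refine ⟨κ - (1 - 3 / 4), max C 0 * U / (4 * Real.pi ^ 2 * c₂), ?_⟩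
  intro W _ _ _ hW
  obtain ⟨D, hD⟩ := hP W hW
  refine ⟨D, ?_⟩
  set N : ℕ := W.conductorNorm ℤ with hNdef
  have hN : (0 : ℝ) < N := by exact_mod_cast Nat.pos_of_ne_zero (NeZero.ne N)
  have hc0 : D.c ≠ 0 := D.maninConstant_ne_zero_holds
  have hcov : 0 < ZLattice.covolume D.L.lattice := ZLattice.covolume_pos _ _
  -- Zagier's identity, real form
  have hZ := congrArg Complex.re D.zagier_degree_formula_holds
  rw [Complex.re_ofReal_mul, Complex.ofReal_re] at hZ
  -- covolume upper bound: `1 ≤ |Δ_min| ≤ max(|Δ|,|c₄|³) ≤ A₀ covol^{-7}`, so `covol ≤ (max A₀ 1)^{1/7}`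
  have hSW := hA₀ W D.L D.isNeronLattice
  have hone : (1 : ℝ) ≤ ((max |W.Δ| (|W.c₄| ^ 3) : ℚ) : ℝ) := by
    have hΔ : (1 : ℚ) ≤ |W.Δ| := by
      rw [← WeierstrassCurve.cast_minimalDiscriminantInt W, ← Int.cast_abs]
      exact_mod_cast Int.one_le_abs (WeierstrassCurve.minimalDiscriminantInt_ne_zero W)
    exact_mod_cast hΔ.trans (le_max_left _ _)
  have hcovU : ZLattice.covolume D.L.lattice ≤ U := by
    have h1 : (1 : ℝ) ≤ max A₀ 1 * ZLattice.covolume D.L.lattice ^ (-(6 + 1 : ℝ)) :=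
      (hone.trans hSW).trans (mul_le_mul_of_nonneg_right (le_max_left _ _) (Real.rpow_nonneg hcov.le _))
    have hA1 : 0 < max A₀ 1 := lt_of_lt_of_le one_pos (le_max_right _ _)
    -- `covol^{7} ≤ max A₀ 1`
    have h2 : ZLattice.covolume D.L.lattice ^ ((6 + 1 : ℝ)) ≤ max A₀ 1 := by
      have h3 : ZLattice.covolume D.L.lattice ^ ((6 + 1 : ℝ)) * 1 ≤
          ZLattice.covolume D.L.lattice ^ ((6 + 1 : ℝ)) *
            (max A₀ 1 * ZLattice.covolume D.L.lattice ^ (-(6 + 1 : ℝ))) :=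
        mul_le_mul_of_nonneg_left h1 (Real.rpow_nonneg hcov.le _)
      have h4 : ZLattice.covolume D.L.lattice ^ ((6 + 1 : ℝ)) *
          (max A₀ 1 * ZLattice.covolume D.L.lattice ^ (-(6 + 1 : ℝ))) = max A₀ 1 := by
        rw [Real.rpow_neg hcov.le, mul_left_comm,
          mul_inv_cancel₀ (Real.rpow_pos_of_pos hcov _).ne', mul_one]
      linarith [h3, h4]
    have h5 := Real.rpow_le_rpow (Real.rpow_nonneg hcov.le _) h2
      (show (0 : ℝ) ≤ 1 / (6 + 1) by norm_num)
    rwa [← Real.rpow_mul hcov.le, show ((6 + 1 : ℝ)) * (1 / (6 + 1)) = 1 by norm_num,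
      Real.rpow_one] at h5
  -- `4π² c² · c₂ N^{1/4} ≤ 4π² c² (f,f) = deg · covol ≤ (max C 0) N^κ · U`
  have hlow : 4 * Real.pi ^ 2 * (D.c : ℝ) ^ 2 * (c₂ * (N : ℝ) ^ (1 - 3 / 4 : ℝ)) ≤
      max C 0 * (N : ℝ) ^ κ * U := by
    have hdeg0 : (0 : ℝ) ≤ (D.deg : ℝ) := by positivity
    calc 4 * Real.pi ^ 2 * (D.c : ℝ) ^ 2 * (c₂ * (N : ℝ) ^ (1 - 3 / 4 : ℝ))
        ≤ 4 * Real.pi ^ 2 * (D.c : ℝ) ^ 2 *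
            (peterssonProduct (Gamma0 N) 2 D.f D.f).re := by
          gcongr
          exact hPet N W D
      _ = (D.deg : ℝ) * ZLattice.covolume D.L.lattice := hZ
      _ ≤ (max C 0 * (N : ℝ) ^ κ) * ZLattice.covolume D.L.lattice := by
          apply mul_le_mul_of_nonneg_right _ hcov.le
          exact hD.trans (mul_le_mul_of_nonneg_right (le_max_left _ _) (by positivity))
      _ ≤ (max C 0 * (N : ℝ) ^ κ) * U := mul_le_mul_of_nonneg_left hcovU (by positivity)
  -- divide by `4π² c₂ N^{1/4}` and use `|c| ≤ c²`
  have hden : 0 < 4 * Real.pi ^ 2 * c₂ * (N : ℝ) ^ (1 - 3 / 4 : ℝ) := by positivity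
  have h' : (D.c : ℝ) ^ 2 * (4 * Real.pi ^ 2 * c₂ * (N : ℝ) ^ (1 - 3 / 4 : ℝ)) ≤
      max C 0 * (N : ℝ) ^ κ * U := by
    calc (D.c : ℝ) ^ 2 * (4 * Real.pi ^ 2 * c₂ * (N : ℝ) ^ (1 - 3 / 4 : ℝ))
        = 4 * Real.pi ^ 2 * (D.c : ℝ) ^ 2 * (c₂ * (N : ℝ) ^ (1 - 3 / 4 : ℝ)) := by ring
      _ ≤ max C 0 * (N : ℝ) ^ κ * U := hlow
  have hc2 : (D.c : ℝ) ^ 2 ≤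
      max C 0 * (N : ℝ) ^ κ * U / (4 * Real.pi ^ 2 * c₂ * (N : ℝ) ^ (1 - 3 / 4 : ℝ)) :=
    (le_div_iff₀ hden).mpr h'
  have hrhs : max C 0 * (N : ℝ) ^ κ * U / (4 * Real.pi ^ 2 * c₂ * (N : ℝ) ^ (1 - 3 / 4 : ℝ)) =
      max C 0 * U / (4 * Real.pi ^ 2 * c₂) * (N : ℝ) ^ (κ - (1 - 3 / 4)) := by
    rw [Real.rpow_sub hN κ (1 - 3 / 4)]
    ring
  have habs : |(D.c : ℝ)| ≤ (D.c : ℝ) ^ 2 := by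
    have h1 : (1 : ℝ) ≤ |(D.c : ℝ)| := by exact_mod_cast Int.one_le_abs hc0
    nlinarith [abs_nonneg (D.c : ℝ), sq_abs (D.c : ℝ)]
  calc |(D.maninConstant : ℝ)| = |(D.c : ℝ)| := rfl
    _ ≤ (D.c : ℝ) ^ 2 := habs
    _ ≤ max C 0 * (N : ℝ) ^ κ * U / (4 * Real.pi ^ 2 * c₂ * (N : ℝ) ^ (1 - 3 / 4 : ℝ)) := hc2
    _ = max C 0 * U / (4 * Real.pi ^ 2 * c₂) * (N : ℝ) ^ (κ - (1 - 3 / 4)) := hrhs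

end Summit.ABC.ABC.Theorems

end
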